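import Summits.ResolutionOfSingularities.ResolutionOfSingularities.Theorems.FrobeniusLadderFInjectiveMacaulayficationSingTowerNesting
import Summits.ResolutionOfSingularities.ResolutionOfSingularities.Theorems.FrobeniusLadderFInjectiveMacaulayficationIntrinsicTowerInstanceP2d4C
import Summits.ResolutionOfSingularities.ResolutionOfSingularities.Theorems.FrobeniusLadderFInjectiveMacaulayficationHypersurfaceRegular
import Literature.AlgebraicGeometry.Resolution.AffineBlowupUnique
import HarnessLib

/-!
# FIRST KERNEL INSTANCE OF `SingFullTowerConjecture`'s TOWER PREDICATE: `RecipeTowerFull singCentre 2 1 (Spec C′)` on the principal τ-floor chart of P2d4C — Sing_red there IS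
# the non-FULL locus `V(x̄, z̄′)`, so the N-recipe instance p632182 transfers verbatim (crux `FInjectiveMacaulayfication` stmt-ResolutionOfSingularities-15315, chain w45a;
# res-L1-w45a-plan-1 RULING R19.17 (L-a); res-L1-w45a-tri-2's chartwise data l.≈81330 «Sing_red = N_red on every chart of the τ-floors»; seat res-L1-w45a-lead-1 g9)

[OURS · L1 W4.5a] Support file (`--supports stmt-ResolutionOfSingularities-15315 --as helper`); NOT a statement of any manuscript; def-free, fact-free, UNCONDITIONAL. AI-written (AI review
is weaker than expert review).

`C′ = k[X₀,…,X₄]/(F′)`, `F′ = X₄² + X₀²X₄ + X₀²(X₁³ + X₂³ + X₃³)` (the `D(x̄²)` chart of `Bl_τ(P2d4C)`, τ = (x², y, u, t, z); res-L1-w45a-stub-2 p615290 / p617159 / p632182), `char k = 2`, any field.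
* §1 THE SINGULAR LOCUS OF `Spec C′` IS `V(x̄, z̄′)` EXACTLY: `TauCentreBlowupFull.pderiv_four_chart` (`∂F′/∂X₄ = X₀²`, res-L1-w45a-stub-2), `mem_XZ_of_mk_X_zero_mem` (`x̄ ∈ P ⇒ z̄′ ∈ P`: `z̄′² = x̄²·(z̄′ + Σ)`),
  `isRegularLocalRing_of_not_le` (off `V(x̄, z̄′)` the partial `X₀²` is a unit — Jacobian sufficiency, any field), and ON `V(x̄, z̄′)` the stalk is not even FULL (p615290
  `TauFloorOneNotFull.not_fullCl_stalk_of_mem_VXZ`), hence not regular (regular ⇒ FULL, `RegTower.fullCl_stalk_of_mem_regularLocus`): ★ `compl_regularLocus_eq_support_XZ`.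
  So on this chart Sing_red COINCIDES with the non-FULL locus (res-L1-w45a-tri-2's engine reports the same on every chart of the τ-floors of P2d4C and P2d4B; they DIFFER on 𝔪-floors).
* §2 ★ `singCentre_eq_idealSheaf_XZ : RegTower.singCentre 2 (Spec C′) = (x̄, z̄′)~` (closure of a closed set; vanishing ideal sheaf of the support of a prime's ideal sheaf = itself,
  p632182 `radical_idealSheaf_of_isPrime`).
* §3 ★★ `recipeTowerFull_singCentre_one : IntrinsicTower.Recipes.RecipeTowerFull RegTower.singCentre 2 1 (Spec C′)` — every blowing up of `Spec C′` along its REDUCED SINGULAR LOCUS is FULL at every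
  point (p617159's «every blowing up along (x̄, z̄′)~ is FULL», via `TauCentreBlowupFull.tauCentre_fHalfShape`); `not_recipeTowerFull_singCentre_zero` (the chart is not FULL); ★
  `singFullTowerHeight_eq_one` — the F-STOP HEIGHT of the Sing_red tower of `Spec C′` is EXACTLY ONE. HONEST LABEL: a positive one-floor instance of v44's F-side predicate on a τ-floor CHART
  (an affine open of an admissible floor, not the whole floor); evidence weight modest; v44 stays HELD on the K-SF table / toric scan.
[folklore assembly; OURS as a certificate; cite: Hartshorne1977, I Thm. 5.1; Fedder1983, Prop. 1.7, Thm. 1.12; GortzWedhorn2020, Prop. 13.92]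
-/

-- single-problem summit: the doubled namespace component is forced
set_option linter.dupNamespace false

noncomputable section

open AlgebraicGeometry CategoryTheory CategoryTheory.Limits Literature.AlgebraicGeometry.Resolution TopologicalSpace IsLocalRing MvPolynomial

namespace Summit.ResolutionOfSingularities.ResolutionOfSingularities.Theorems.FInjectiveMacaulayfication.RegTower.InstanceTauFloorP2d4C

open Summit.ResolutionOfSingularities.ResolutionOfSingularities.Theorems.FInjectiveMacaulayfication
open SliceableCentre IntrinsicTower IntrinsicTower.Recipes RegTower

/-! ## §1 The singular locus of the chart is `V(x̄, z̄′)` -/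

/-- In `C′`: `x̄ ∈ P ⇒ z̄′ ∈ P` for every prime `P` (`z̄′² = x̄²·z̄′ + x̄²·Σ`). [folklore] -/
theorem mem_XZ_of_mk_X_zero_mem (k : Type) [Field k] (F' : MvPolynomial (Fin 5) k)
    (hF : F' = X 4 ^ 2 + X 0 ^ 2 * X 4 + X 0 ^ 2 * (X 1 ^ 3 + X 2 ^ 3 + X 3 ^ 3))
    (P : Ideal (MvPolynomial (Fin 5) k ⧸ Ideal.span {F'})) [P.IsPrime] (hx : Ideal.Quotient.mk (Ideal.span {F'}) (X 0) ∈ P) :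
    Ideal.Quotient.mk (Ideal.span {F'}) (X 4) ∈ P := by
  have hF0 : Ideal.Quotient.mk (Ideal.span {F'}) F' = 0 := Ideal.Quotient.eq_zero_iff_mem.mpr (Ideal.mem_span_singleton_self F')
  have hsq : Ideal.Quotient.mk (Ideal.span {F'}) (X 4) ^ 2 =
      -(Ideal.Quotient.mk (Ideal.span {F'}) (X 0) ^ 2 * (Ideal.Quotient.mk (Ideal.span {F'}) (X 4) + Ideal.Quotient.mk (Ideal.span {F'}) (X 1 ^ 3 + X 2 ^ 3 + X 3 ^ 3))) := by
    have h : Ideal.Quotient.mk (Ideal.span {F'}) (X 4) ^ 2 + Ideal.Quotient.mk (Ideal.span {F'}) (X 0) ^ 2 *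
        (Ideal.Quotient.mk (Ideal.span {F'}) (X 4) + Ideal.Quotient.mk (Ideal.span {F'}) (X 1 ^ 3 + X 2 ^ 3 + X 3 ^ 3)) = 0 := by
      rw [← hF0, hF]
      simp only [map_add, map_mul, map_pow]
      ring
    exact eq_neg_of_add_eq_zero_left h
  have hmem : Ideal.Quotient.mk (Ideal.span {F'}) (X 4) ^ 2 ∈ P := by
    rw [hsq]
    exact P.neg_mem (Ideal.mul_mem_right _ _ (Ideal.pow_mem_of_mem P hx 2 (by norm_num)))
  exact ‹P.IsPrime›.mem_of_pow_mem 2 hmem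

/-- ★ **`Spec C′` is REGULAR at every prime `P ⊉ (x̄, z̄′)`**: then `x̄ ∉ P` and `∂F′/∂X₄ = X₀²` is a unit at `P` (Jacobian sufficiency over any field). [cite: Hartshorne1977, I Thm. 5.1] -/
theorem isRegularLocalRing_of_not_le (k : Type) [Field k] [CharP k 2] (F' : MvPolynomial (Fin 5) k)
    (hF : F' = X 4 ^ 2 + X 0 ^ 2 * X 4 + X 0 ^ 2 * (X 1 ^ 3 + X 2 ^ 3 + X 3 ^ 3))
    (P : Ideal (MvPolynomial (Fin 5) k ⧸ Ideal.span {F'})) [P.IsPrime]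
    (hP : ¬ Ideal.span ({Ideal.Quotient.mk (Ideal.span {F'}) (X 0), Ideal.Quotient.mk (Ideal.span {F'}) (X 4)} : Set (MvPolynomial (Fin 5) k ⧸ Ideal.span {F'})) ≤ P) :
    IsRegularLocalRing (Localization.AtPrime P) := by
  have hx : Ideal.Quotient.mk (Ideal.span {F'}) (X 0) ∉ P := by
    intro hx
    apply hP
    rw [Ideal.span_le]
    rintro a (rfl | rfl)
    · exact hx
    · exact mem_XZ_of_mk_X_zero_mem k F' hF P hx
  refine HypersurfaceRegular.stub_hypersurfaceRegularOfPderiv k 5 F' 4 P ?_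
  rw [TauCentreBlowupFull.pderiv_four_chart k F' hF]
  intro h
  exact hx ((Ideal.comap_isPrime _ P).mem_of_pow_mem 2 h)

/-- ★ **THE SINGULAR LOCUS OF `Spec C′` IS `V(x̄, z̄′)`** (= the support of `(x̄, z̄′)~`): off it §1's Jacobian, on it the stalk is not FULL (p615290), hence not regular. [folklore assembly] -/
theorem compl_regularLocus_eq_support_XZ (k : Type) [Field k] [CharP k 2] (F' : MvPolynomial (Fin 5) k)
    (hF : F' = X 4 ^ 2 + X 0 ^ 2 * X 4 + X 0 ^ 2 * (X 1 ^ 3 + X 2 ^ 3 + X 3 ^ 3)) :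
    (Scheme.regularLocus (Spec (.of (MvPolynomial (Fin 5) k ⧸ Ideal.span {F'}))))ᶜ =
      ((affineBlowup.idealSheaf (Ideal.span ({Ideal.Quotient.mk (Ideal.span {F'}) (X 0), Ideal.Quotient.mk (Ideal.span {F'}) (X 4)} :
        Set (MvPolynomial (Fin 5) k ⧸ Ideal.span {F'})))).support : Set (Spec (.of (MvPolynomial (Fin 5) k ⧸ Ideal.span {F'})))) := by
  haveI : Fact (Nat.Prime 2) := ⟨Nat.prime_two⟩
  ext w
  rw [Set.mem_compl_iff]
  constructor
  · intro hw
    by_contra hmem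
    apply hw
    refine FermatCubicConeGerm.mem_regularLocus_Spec_of_isRegularLocalRing w (isRegularLocalRing_of_not_le k F' hF w.asIdeal ?_)
    intro hle
    apply hmem
    rw [affineBlowup.support_idealSheaf]
    exact fun a ha => hle ha
  · intro hmem hreg
    rw [affineBlowup.support_idealSheaf] at hmem
    have hx : Ideal.Quotient.mk (Ideal.span {F'}) (X 0) ∈ w.asIdeal := hmem (Ideal.subset_span (Or.inl rfl))
    have hz : Ideal.Quotient.mk (Ideal.span {F'}) (X 4) ∈ w.asIdeal := hmem (Ideal.subset_span (Or.inr rfl))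
    exact TauFloorOneNotFull.not_fullCl_stalk_of_mem_VXZ k F' hF w hx hz
      (fullCl_stalk_of_mem_regularLocus 2 (Spec.map (CommRingCat.ofHom (algebraMap k (MvPolynomial (Fin 5) k ⧸ Ideal.span {F'})))) w hreg)

/-! ## §2 The Sing_red centre of the chart is `(x̄, z̄′)~` -/

/-- ★ **`RegTower.singCentre 2 (Spec C′) = (x̄, z̄′)~`**: the singular locus is the closed set `supp (x̄, z̄′)~`, whose vanishing ideal sheaf is the radical of `(x̄, z̄′)~`, i.e. itself
(`(x̄, z̄′)` is prime, p615290; p632182 `radical_idealSheaf_of_isPrime`). [folklore assembly] -/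
theorem singCentre_eq_idealSheaf_XZ (k : Type) [Field k] [CharP k 2] (F' : MvPolynomial (Fin 5) k)
    (hF : F' = X 4 ^ 2 + X 0 ^ 2 * X 4 + X 0 ^ 2 * (X 1 ^ 3 + X 2 ^ 3 + X 3 ^ 3)) :
    singCentre 2 (Spec (.of (MvPolynomial (Fin 5) k ⧸ Ideal.span {F'}))) =
      affineBlowup.idealSheaf (Ideal.span ({Ideal.Quotient.mk (Ideal.span {F'}) (X 0), Ideal.Quotient.mk (Ideal.span {F'}) (X 4)} :
        Set (MvPolynomial (Fin 5) k ⧸ Ideal.span {F'}))) := by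
  haveI := TauFloorOneNotFull.primeXZ_isPrime k F' hF
  have hcl : (⟨closure ((Scheme.regularLocus (Spec (.of (MvPolynomial (Fin 5) k ⧸ Ideal.span {F'}))))ᶜ), isClosed_closure⟩ :
      Closeds (Spec (.of (MvPolynomial (Fin 5) k ⧸ Ideal.span {F'})))) =
      (affineBlowup.idealSheaf (Ideal.span ({Ideal.Quotient.mk (Ideal.span {F'}) (X 0), Ideal.Quotient.mk (Ideal.span {F'}) (X 4)} :
        Set (MvPolynomial (Fin 5) k ⧸ Ideal.span {F'})))).support := by
    apply Closeds.ext
    change closure _ = _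
    rw [compl_regularLocus_eq_support_XZ k F' hF]
    exact (Scheme.IdealSheafData.support _).isClosed.closure_eq
  change Scheme.IdealSheafData.vanishingIdeal _ = _
  rw [hcl, Scheme.IdealSheafData.vanishingIdeal_support, IntrinsicTower.InstanceTauFloorP2d4C.radical_idealSheaf_of_isPrime]

/-! ## §3 ★★ The Sing_red tower of the chart is FULL after ONE floor, and not before -/

/-- ★★ **`RecipeTowerFull singCentre 2 1 (Spec C′)`**: EVERY blowing up of the principal τ-floor chart of P2d4C along its REDUCED SINGULAR LOCUS is FULL at every point
(§2 + p617159 «every blowing up along `(x̄, z̄′)~` is FULL», through `TauCentreBlowupFull.tauCentre_fHalfShape`). The first kernel instance of v44's F-side tower predicate.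
[OURS · certificate; cite: Fedder1983, Thm. 1.12; GortzWedhorn2020, Prop. 13.92] -/
theorem recipeTowerFull_singCentre_one (k : Type) [Field k] [CharP k 2] (F' : MvPolynomial (Fin 5) k)
    (hF : F' = X 4 ^ 2 + X 0 ^ 2 * X 4 + X 0 ^ 2 * (X 1 ^ 3 + X 2 ^ 3 + X 3 ^ 3)) :
    RecipeTowerFull singCentre 2 1 (Spec (.of (MvPolynomial (Fin 5) k ⧸ Ideal.span {F'}))) := by
  rw [recipeTowerFull_succ]
  intro S₁ g hg
  rw [singCentre_eq_idealSheaf_XZ k F' hF] at hg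
  exact (TauCentreBlowupFull.tauCentre_fHalfShape k F' hF).2.2 S₁ g hg

/-- **`¬ RecipeTowerFull singCentre 2 0 (Spec C′)`**: the chart itself is NOT FULL (the generic point of `V(x̄, z̄′)`, p615290). [OURS · certificate; cite: Fedder1983, Prop. 1.7] -/
theorem not_recipeTowerFull_singCentre_zero (k : Type) [Field k] [CharP k 2] (F' : MvPolynomial (Fin 5) k)
    (hF : F' = X 4 ^ 2 + X 0 ^ 2 * X 4 + X 0 ^ 2 * (X 1 ^ 3 + X 2 ^ 3 + X 3 ^ 3)) :
    ¬ RecipeTowerFull singCentre 2 0 (Spec (.of (MvPolynomial (Fin 5) k ⧸ Ideal.span {F'}))) := by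
  rw [recipeTowerFull_zero]
  intro h
  haveI := TauFloorOneNotFull.primeXZ_isPrime k F' hF
  let w : Spec (.of (MvPolynomial (Fin 5) k ⧸ Ideal.span {F'})) :=
    ⟨Ideal.span ({Ideal.Quotient.mk (Ideal.span {F'}) (X 0), Ideal.Quotient.mk (Ideal.span {F'}) (X 4)} :
      Set (MvPolynomial (Fin 5) k ⧸ Ideal.span {F'})), inferInstance⟩
  exact TauFloorOneNotFull.not_fullCl_stalk_of_mem_VXZ k F' hF w (Ideal.subset_span (Or.inl rfl)) (Ideal.subset_span (Or.inr rfl)) (h w)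

/-- ★ **THE Sing_red TOWER OF `Spec C′` REACHES FULL AT HEIGHT EXACTLY ONE** (`¬ RecipeTowerFull singCentre 2 0 ∧ RecipeTowerFull singCentre 2 1`). HONEST LABEL: one τ-floor CHART of one
specimen; on this chart the Sing_red recipe and the N-recipe coincide (§1), so the content beyond p632182 is exactly §1–§2. [OURS · certificate] -/
theorem singFullTowerHeight_eq_one (k : Type) [Field k] [CharP k 2] (F' : MvPolynomial (Fin 5) k)
    (hF : F' = X 4 ^ 2 + X 0 ^ 2 * X 4 + X 0 ^ 2 * (X 1 ^ 3 + X 2 ^ 3 + X 3 ^ 3)) :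
    ¬ RecipeTowerFull singCentre 2 0 (Spec (.of (MvPolynomial (Fin 5) k ⧸ Ideal.span {F'}))) ∧
      RecipeTowerFull singCentre 2 1 (Spec (.of (MvPolynomial (Fin 5) k ⧸ Ideal.span {F'}))) :=
  ⟨not_recipeTowerFull_singCentre_zero k F' hF, recipeTowerFull_singCentre_one k F' hF⟩

end Summit.ResolutionOfSingularities.ResolutionOfSingularities.Theorems.FInjectiveMacaulayfication.RegTower.InstanceTauFloorP2d4C

end
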